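import Summits.CriticalPhenomena.PercolationContinuityZ3.Theorems.Transplant.SkelPhiNegReachRoomsRun
import Summits.CriticalPhenomena.PercolationContinuityZ3.Theorems.Transplant.KNParaChainSchedN
import HarnessLib

/-!
# N1 (the `{±1}` node), (C) column file (C-A4): THE RUN-FRAME FOOTPRINT ROOMS FROM NUMERIC READINGS — the reading vectors `Skelφ.rdLo / rdHi` of a run
# box `Icc lo hi` (the signed numerators of (C-A2), coordinatewise), `fine_mem_Icc_rd` (`R v ∈ Icc lo hi ⇒ F v ∈ cen + [rdLo, rdHi]` at a frame-change
# vertex `F c₀ = cen y`), and the three discharges of the POINTWISE rooms of `reachOblAtHN_negCorridor` (C-A3) from inequalities on `rdLo/rdHi` at the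
# corridor's axis `du.1` (split by the sign `sgOf du`) and across it: `room_Q_union_Hfull_of_rd` (a region's footprints in `Q_y ∪ H_{y,du}`),
# `room_last_of_rd` (the last core's footprints in `H_{y,du}` with their unit boxes in `M_{y+du}`), and the `∀ k`-forms over the rounds' regions
# `P₂.pregion 0 0 k`, the band's regions `B.pregion aB σB 0 j` and the band's last core (`dBox` corners `dLo/dHi`).

builds on p205010 (kernel theorem, internal audit signed; external expert review pending) — nothing in this file uses p205010; nothing here is a
claim about the open node `SamePDropOfSkeletonNeg`.
Lane `prim-bschramm`, seat `prim-bschramm-p5` (gen 8; (C) lineage); helper file (`--supports stmt-CriticalPhenomena-4575`).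
[cite: KozmaNitzan2024, §4 p. 26 (Q_v, M_v, H_{v,x}), Lemma 12 (pp. 23–25)] [cite: MartineauTassion2017, §4.1]
-/

noncomputable section

namespace Summit.CriticalPhenomena.PercolationContinuityZ3.Theorems

namespace Transplant

namespace Skelφ

open Literature.Probability.Percolation Literature.Probability.LatticeModels SimpleGraph GadgetSystem Contour
open Literature.Probability.Percolation.KozmaNitzan
open Literature.Probability.Percolation.KozmaNitzan.Cells (oth oth_ne sgOf sgOf_sign eq_oth_of_ne)
open TwoAxis.Para (modulus)
open ChainPlanar ChainPara

variable {V : Type} {G : SimpleGraph V} {φ : V → Site 2}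

/-! ## §1 The reading vectors of a run box -/

/-- **Lower fine readings of the run box `[lo, hi]`**: `(⌊c₀'(A(m·lo₀ − max(vα·U lo₁, vα·(U hi₁ + U − 1)))/n)/D⌋, ⌊c₁'A·U lo₁/D⌋)`. [this work] -/
def rdLo (A : ℤ) (n : ℕ) (h vα vβ c₀' c₁' D : ℤ) (lo hi : Site 2) : Site 2 :=
  ![(c₀' * (A * (modulus n h vα vβ * lo 0 - max (vα * ((shearUnit n h : ℤ) * lo 1)) (vα * ((shearUnit n h : ℤ) * hi 1 + shearUnit n h - 1))) / n)) / D,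
    (c₁' * (A * ((shearUnit n h : ℤ) * lo 1))) / D]

/-- **Upper fine readings of the run box `[lo, hi]`**: `(⌊c₀'(A(m·hi₀ − min(…))/n)/D⌋ + 1, ⌊c₁'A·(U hi₁ + U − 1)/D⌋ + 1)`. [this work] -/
def rdHi (A : ℤ) (n : ℕ) (h vα vβ c₀' c₁' D : ℤ) (lo hi : Site 2) : Site 2 :=
  ![(c₀' * (A * (modulus n h vα vβ * hi 0 - min (vα * ((shearUnit n h : ℤ) * lo 1)) (vα * ((shearUnit n h : ℤ) * hi 1 + shearUnit n h - 1))) / n)) / D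
      + 1,
    (c₁' * (A * ((shearUnit n h : ℤ) * hi 1 + shearUnit n h - 1))) / D + 1]

section Read

variable {t₀ c₀ : V} {A : ℤ} {n : ℕ} {h vα vβ c₀' c₁' s₀ s₁ D : ℤ} {P : PCells2} {y : Site 2} {du : MDir}

/-- **A run box read into the fine map at a frame-change vertex**: `runX φ c₀ n h 1 v ∈ Icc lo hi`, `fineSkel c₀ = cen y` ⟹
`rdLo i ≤ fineSkel v i − cen y i ≤ rdHi i`. [cite: KozmaNitzan2024, §4 Lemma 12 (pp. 23–25)] -/
theorem fine_sub_cen_mem_rd (hA : 0 ≤ A) (hn : 1 ≤ n) (hm : 0 ≤ modulus n h vα vβ) (hc₀ : 0 ≤ c₀') (hc₁ : 0 ≤ c₁') (hD : 0 < D)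
    (hcen : fineSkel φ t₀ A n h vα vβ c₀' c₁' s₀ s₁ D c₀ = P.cen y) {lo hi : Site 2} {v : V} (hv : runX φ c₀ n h 1 v ∈ Finset.Icc lo hi) (i : Fin 2) :
    rdLo A n h vα vβ c₀' c₁' D lo hi i ≤ fineSkel φ t₀ A n h vα vβ c₀' c₁' s₀ s₁ D v i - P.cen y i ∧
      fineSkel φ t₀ A n h vα vβ c₀' c₁' s₀ s₁ D v i - P.cen y i ≤ rdHi A n h vα vβ c₀' c₁' D lo hi i := by
  obtain ⟨⟨h0l, h0u⟩, h1l, h1u⟩ := fine_sub_bounds_of_runX_mem_Icc_signed (s₀ := s₀) (s₁ := s₁) t₀ hA hn hm hc₀ hc₁ hD c₀ hv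
  rw [← hcen]
  fin_cases i
  · exact ⟨h0l, h0u⟩
  · exact ⟨h1l, h1u⟩

/-- **A region's footprints lie in `Q_y ∪ H_{y,du}`** from the readings: along the corridor's axis `−5r∥ ≤ lev ≤ 22r∥` (sign-split), across it
`|·| ≤ 2r⊥`. [cite: KozmaNitzan2024, §4 p. 26 (Q_v, H_{v,x})] -/
theorem room_Q_union_Hfull_of_rd (hA : 0 ≤ A) (hn : 1 ≤ n) (hm : 0 ≤ modulus n h vα vβ) (hc₀ : 0 ≤ c₀') (hc₁ : 0 ≤ c₁') (hD : 0 < D)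
    (hcen : fineSkel φ t₀ A n h vα vβ c₀' c₁' s₀ s₁ D c₀ = P.cen y) {lo hi : Site 2}
    (hl₁ : sgOf du = 1 → -(5 * (P.r du.1 : ℤ)) ≤ rdLo A n h vα vβ c₀' c₁' D lo hi du.1 ∧ rdHi A n h vα vβ c₀' c₁' D lo hi du.1 ≤ 22 * (P.r du.1 : ℤ))
    (hl₂ : sgOf du = -1 → -(5 * (P.r du.1 : ℤ)) ≤ -rdHi A n h vα vβ c₀' c₁' D lo hi du.1 ∧ -rdLo A n h vα vβ c₀' c₁' D lo hi du.1 ≤ 22 * (P.r du.1 : ℤ))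
    (ht : -(2 * (P.r (oth du.1) : ℤ)) ≤ rdLo A n h vα vβ c₀' c₁' D lo hi (oth du.1) ∧ rdHi A n h vα vβ c₀' c₁' D lo hi (oth du.1) ≤ 2 * (P.r (oth du.1) : ℤ))
    {v : V} (hv : runX φ c₀ n h 1 v ∈ Finset.Icc lo hi) :
    fineSkel φ t₀ A n h vα vβ c₀' c₁' s₀ s₁ D v ∈ P.Q y ∪ P.Hfull y du := by
  have hpar := fine_sub_cen_mem_rd hA hn hm hc₀ hc₁ hD hcen hv du.1
  have hperp := fine_sub_cen_mem_rd hA hn hm hc₀ hc₁ hD hcen hv (oth du.1)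
  refine P.mem_Q_union_Hfull_of_lev ?_ ?_ (by linarith [hperp.1, ht.1]) (by linarith [hperp.2, ht.2])
  · rw [PCells2.lev_def]
    rcases sgOf_sign du with hs | hs <;> rw [hs]
    · have := (hl₁ hs).1; linarith [hpar.1]
    · have := (hl₂ hs).1; linarith [hpar.2]
  · rw [PCells2.lev_def]
    rcases sgOf_sign du with hs | hs <;> rw [hs]
    · have := (hl₁ hs).2; linarith [hpar.2]
    · have := (hl₂ hs).2; linarith [hpar.1]

/-- **The last core's footprints lie in `H_{y,du}` with their unit boxes in `M_{y+du}`** from the readings: along `17r∥ + 1 ≤ lev ≤ 22r∥` (sign-split),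
across `|·| ≤ 2r⊥`. [cite: KozmaNitzan2024, §4 p. 26 (M_v, H_{v,x})] -/
theorem room_last_of_rd (hA : 0 ≤ A) (hn : 1 ≤ n) (hm : 0 ≤ modulus n h vα vβ) (hc₀ : 0 ≤ c₀') (hc₁ : 0 ≤ c₁') (hD : 0 < D)
    (hcen : fineSkel φ t₀ A n h vα vβ c₀' c₁' s₀ s₁ D c₀ = P.cen y) {lo hi : Site 2}
    (hl₁ : sgOf du = 1 → 17 * (P.r du.1 : ℤ) + 1 ≤ rdLo A n h vα vβ c₀' c₁' D lo hi du.1 ∧ rdHi A n h vα vβ c₀' c₁' D lo hi du.1 ≤ 22 * (P.r du.1 : ℤ))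
    (hl₂ : sgOf du = -1 → 17 * (P.r du.1 : ℤ) + 1 ≤ -rdHi A n h vα vβ c₀' c₁' D lo hi du.1 ∧ -rdLo A n h vα vβ c₀' c₁' D lo hi du.1 ≤ 22 * (P.r du.1 : ℤ))
    (ht : -(2 * (P.r (oth du.1) : ℤ)) ≤ rdLo A n h vα vβ c₀' c₁' D lo hi (oth du.1) ∧ rdHi A n h vα vβ c₀' c₁' D lo hi (oth du.1) ≤ 2 * (P.r (oth du.1) : ℤ))
    {v : V} (hv : runX φ c₀ n h 1 v ∈ Finset.Icc lo hi) :
    fineSkel φ t₀ A n h vα vβ c₀' c₁' s₀ s₁ D v ∈ P.Hfull y du ∧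
      Finset.Icc (fineSkel φ t₀ A n h vα vβ c₀' c₁' s₀ s₁ D v - 1) (fineSkel φ t₀ A n h vα vβ c₀' c₁' s₀ s₁ D v + 1) ⊆ P.M (y + stepVec du) := by
  have hpar := fine_sub_cen_mem_rd hA hn hm hc₀ hc₁ hD hcen hv du.1
  have hperp := fine_sub_cen_mem_rd hA hn hm hc₀ hc₁ hD hcen hv (oth du.1)
  have hr := P.one_le_r (oth du.1)
  have hr' : (1 : ℤ) ≤ P.r (oth du.1) := by exact_mod_cast hr
  have hlev : 17 * (P.r du.1 : ℤ) + 1 ≤ P.lev du y (fineSkel φ t₀ A n h vα vβ c₀' c₁' s₀ s₁ D v) ∧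
      P.lev du y (fineSkel φ t₀ A n h vα vβ c₀' c₁' s₀ s₁ D v) ≤ 22 * (P.r du.1 : ℤ) := by
    rw [PCells2.lev_def]
    rcases sgOf_sign du with hs | hs <;> rw [hs]
    · obtain ⟨h1, h2⟩ := hl₁ hs; constructor <;> linarith [hpar.1, hpar.2]
    · obtain ⟨h1, h2⟩ := hl₂ hs; constructor <;> linarith [hpar.1, hpar.2]
  refine ⟨P.mem_Hfull_of_lev (by linarith [hlev.1, Int.natCast_nonneg (P.r du.1)]) hlev.2 (by linarith [hperp.1, ht.1]) (by linarith [hperp.2, ht.2]),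
    P.Icc_unit_subset_M_add_of_lev hlev.1 (by linarith [hlev.2, Int.natCast_nonneg (P.r du.1)]) (by linarith [hperp.1, ht.1])
      (by linarith [hperp.2, ht.2])⟩

end Read

/-! ## §2 The `∀ k`-forms over the run-frame segment's regions and last core -/

section Rooms

variable {t₀ c₀ : V} {A : ℤ} {n : ℕ} {h vα vβ c₀' c₁' s₀ s₁ D : ℤ} {P : PCells2} {y : Site 2} {du : MDir}
  (hA : 0 ≤ A) (hn : 1 ≤ n) (hm : 0 ≤ modulus n h vα vβ) (hc₀ : 0 ≤ c₀') (hc₁ : 0 ≤ c₁') (hD : 0 < D)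
  (hcen : fineSkel φ t₀ A n h vα vβ c₀' c₁' s₀ s₁ D c₀ = P.cen y)
include hA hn hm hc₀ hc₁ hD hcen

/-- **The rounds' regions `P₂.pregion 0 0 k` (run frame, centre `0`) have footprints in `Q_y ∪ H_{y,du}`** from the readings of their corners
`dLo/dHi 0 1 0 (−L_k − e − La) (L_k + e + La) (−W_k − e − Lb) (W_k + e + Lb)`. [cite: KozmaNitzan2024, §4 Lemma 12 (pp. 23–25)] -/
theorem room₂_of_rd (P₂ : LocPrm)
    (hrd : ∀ k ≤ P₂.N,
      let lo := dLo 0 1 0 (-(P₂.L k + P₂.e + P₂.La)) (P₂.L k + P₂.e + P₂.La) (-(P₂.Wk k + P₂.e + P₂.Lb)) (P₂.Wk k + P₂.e + P₂.Lb)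
      let hi := dHi 0 1 0 (-(P₂.L k + P₂.e + P₂.La)) (P₂.L k + P₂.e + P₂.La) (-(P₂.Wk k + P₂.e + P₂.Lb)) (P₂.Wk k + P₂.e + P₂.Lb)
      (sgOf du = 1 → -(5 * (P.r du.1 : ℤ)) ≤ rdLo A n h vα vβ c₀' c₁' D lo hi du.1 ∧ rdHi A n h vα vβ c₀' c₁' D lo hi du.1 ≤ 22 * (P.r du.1 : ℤ)) ∧
      (sgOf du = -1 → -(5 * (P.r du.1 : ℤ)) ≤ -rdHi A n h vα vβ c₀' c₁' D lo hi du.1 ∧ -rdLo A n h vα vβ c₀' c₁' D lo hi du.1 ≤ 22 * (P.r du.1 : ℤ)) ∧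
      (-(2 * (P.r (oth du.1) : ℤ)) ≤ rdLo A n h vα vβ c₀' c₁' D lo hi (oth du.1) ∧
        rdHi A n h vα vβ c₀' c₁' D lo hi (oth du.1) ≤ 2 * (P.r (oth du.1) : ℤ))) :
    ∀ k ≤ P₂.N, ∀ v : V, runX φ c₀ n h 1 v ∈ P₂.pregion 0 0 k → fineSkel φ t₀ A n h vα vβ c₀' c₁' s₀ s₁ D v ∈ P.Q y ∪ P.Hfull y du := by
  intro k hk v hv
  obtain ⟨h1, h2, h3⟩ := hrd k hk
  exact room_Q_union_Hfull_of_rd hA hn hm hc₀ hc₁ hD hcen h1 h2 h3 hv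

/-- **The band's regions `B.pregion aB σB 0 j` have footprints in `Q_y ∪ H_{y,du}`** from the readings of their corners.
[cite: KozmaNitzan2024, §4 Lemma 12 (pp. 23–25)] -/
theorem roomB_of_rd (B : RunPrm) (aB : Fin 2) (σB : ℤ)
    (hrd : ∀ j ≤ B.N,
      let lo := dLo aB σB 0 (B.aLo j - B.ea - B.La) (B.aHi j + B.ea + B.La) (B.bLo j - B.eb - B.Lb) (B.bHi j + B.eb + B.Lb)
      let hi := dHi aB σB 0 (B.aLo j - B.ea - B.La) (B.aHi j + B.ea + B.La) (B.bLo j - B.eb - B.Lb) (B.bHi j + B.eb + B.Lb)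
      (sgOf du = 1 → -(5 * (P.r du.1 : ℤ)) ≤ rdLo A n h vα vβ c₀' c₁' D lo hi du.1 ∧ rdHi A n h vα vβ c₀' c₁' D lo hi du.1 ≤ 22 * (P.r du.1 : ℤ)) ∧
      (sgOf du = -1 → -(5 * (P.r du.1 : ℤ)) ≤ -rdHi A n h vα vβ c₀' c₁' D lo hi du.1 ∧ -rdLo A n h vα vβ c₀' c₁' D lo hi du.1 ≤ 22 * (P.r du.1 : ℤ)) ∧
      (-(2 * (P.r (oth du.1) : ℤ)) ≤ rdLo A n h vα vβ c₀' c₁' D lo hi (oth du.1) ∧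
        rdHi A n h vα vβ c₀' c₁' D lo hi (oth du.1) ≤ 2 * (P.r (oth du.1) : ℤ))) :
    ∀ j ≤ B.N, ∀ v : V, runX φ c₀ n h 1 v ∈ B.pregion aB σB 0 j → fineSkel φ t₀ A n h vα vβ c₀' c₁' s₀ s₁ D v ∈ P.Q y ∪ P.Hfull y du := by
  intro j hj v hv
  obtain ⟨h1, h2, h3⟩ := hrd j hj
  exact room_Q_union_Hfull_of_rd hA hn hm hc₀ hc₁ hD hcen h1 h2 h3 hv

/-- **The band's last core `B.pcore aB σB 0 (B.N+1)` has footprints in `H_{y,du}` with unit boxes in `M_{y+du}`** from the readings of its corners.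
[cite: KozmaNitzan2024, §4 Lemma 12 (pp. 23–25), p. 26 (M_v)] -/
theorem roomL_of_rd (B : RunPrm) (aB : Fin 2) (σB : ℤ)
    (hrd :
      let lo := dLo aB σB 0 (B.aLo (B.N + 1)) (B.aHi (B.N + 1)) (B.bLo (B.N + 1)) (B.bHi (B.N + 1))
      let hi := dHi aB σB 0 (B.aLo (B.N + 1)) (B.aHi (B.N + 1)) (B.bLo (B.N + 1)) (B.bHi (B.N + 1))
      (sgOf du = 1 → 17 * (P.r du.1 : ℤ) + 1 ≤ rdLo A n h vα vβ c₀' c₁' D lo hi du.1 ∧ rdHi A n h vα vβ c₀' c₁' D lo hi du.1 ≤ 22 * (P.r du.1 : ℤ)) ∧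
      (sgOf du = -1 → 17 * (P.r du.1 : ℤ) + 1 ≤ -rdHi A n h vα vβ c₀' c₁' D lo hi du.1 ∧ -rdLo A n h vα vβ c₀' c₁' D lo hi du.1 ≤ 22 * (P.r du.1 : ℤ)) ∧
      (-(2 * (P.r (oth du.1) : ℤ)) ≤ rdLo A n h vα vβ c₀' c₁' D lo hi (oth du.1) ∧
        rdHi A n h vα vβ c₀' c₁' D lo hi (oth du.1) ≤ 2 * (P.r (oth du.1) : ℤ))) :
    ∀ v : V, runX φ c₀ n h 1 v ∈ B.pcore aB σB 0 (B.N + 1) →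
      fineSkel φ t₀ A n h vα vβ c₀' c₁' s₀ s₁ D v ∈ P.Hfull y du ∧
        Finset.Icc (fineSkel φ t₀ A n h vα vβ c₀' c₁' s₀ s₁ D v - 1) (fineSkel φ t₀ A n h vα vβ c₀' c₁' s₀ s₁ D v + 1) ⊆ P.M (y + stepVec du) := by
  intro v hv
  obtain ⟨h1, h2, h3⟩ := hrd
  exact room_last_of_rd hA hn hm hc₀ hc₁ hD hcen h1 h2 h3 hv

end Rooms

end Skelφ

end Transplant

end Summit.CriticalPhenomena.PercolationContinuityZ3.Theorems

end
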